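import Mathlib
import Summits.AnomalousDissipation.AnomalousDissipation.Theses.DyadicWallCascade
import Literature.Uncategorized.SteadyNSRealAnalytic
import Summits.AnomalousDissipation.AnomalousDissipation.Theorems.DyadicRealisation.Negative.WallProfileExistsFalseOfSteadyNSRealAnalytic

/-!
# No exact far-field matching for a viscous wall profile
# — negative lemmas for the crux `ViscousContinuation` of route `DyadicWallCascade`
# (item stmt-AnomalousDissipation-17917; support item stmt-AnomalousDissipation-17919)

Refuter file, Negative lane (D-0016), `Summits/AnomalousDissipation`, sub-problem `AnomalousDissipation`.

Context.  The crux `ViscousContinuation` is, by `rfl`, the implication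
`HalfSpaceHierarchy → ViscousWallProfile`: a bounded smooth mirror-symmetric force-free steady
Navier–Stokes pair `(W, P)` on `ℝ³` (at `ν = 1`) whose dyadic blow-downs `W (2^m • X)` converge,
uniformly on the band `1 ≤ X₂ ≤ 2`, to a half-space hierarchy `V` (steady Euler, `1`-periodic in
`x, y` on the band, dilation invariant, zero mass flux, energy flux `F ≠ 0` through the unit square
of `X₂ = 1`).  Its refutation is `HalfSpaceHierarchy ∧ ¬ ViscousWallProfile` (crux #2 is open, and
`¬ ViscousWallProfile` is a Liouville theorem beyond the known ones), so the disprover's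
kernel-checked output is the refutation of the NATURAL STRENGTHENINGS a construction might aim for.
Three exactness properties are excluded here, each forcing `F = 0` from zero mass flux:

1. `energyFlux_eq_zero_of_exactLevel_blowdown` (uses the tree's PROVED real-analyticity of smooth
   entire steady Navier–Stokes flows, `Literature.Uncategorized.SteadyNSRealAnalytic_holds`):
   the blow-down cannot be EXACT at any single level — if `W (2^m • X) = V X` on the band for one
   `m`, then `2^m • e₀`, `2^m • e₁` are periods of `W` on the slab `2^m ≤ Y₂ ≤ 2^(m+1)`, the
   identity principle (`periodic_of_analytic_of_band`, the off-centre version of the tree's slab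
   lemma) spreads them to `ℝ³`, and the tree lemmas `periodic_nat_mul`, `const_on_line` make the
   blow-down limit constant along horizontal lines: the trace `q ↦ V (q₁, q₂, 1)` is constant, zero
   mass flux kills its vertical component and the energy-flux integrand.  For the provers of
   stmt-17917 (line TruncatedProfiles → ProfileLimit): the matching layer between `W` and `V` is
   infinitely thick — `W ≠ V` somewhere on EVERY dyadic band, the convergence `W - V → 0` is
   genuinely asymptotic, and no truncation "`W = V` above height `2^K`" is itself a profile.  This
   is the outer analogue of the landed inner statement `energyFlux_eq_zero_of_slabPeriodic_blowdown`
   (`NoExactInnerGluing.lean`), now unconditional.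
2. `energyFlux_eq_zero_of_two_smul_invariant`: the profile cannot itself be discretely
   self-similar — `W (2 • X) = W X` with continuity at the origin makes `W` constant.
3. `energyFlux_eq_zero_of_eq_on_halfSpace`: the profile cannot coincide with the (dilation
   invariant) hierarchy on the whole open half-space — the same collapse through the origin.

Only the clauses named in each statement are used (no mirror symmetry, no pressure bound, no Euler
structure of `V`); in particular 2 and 3 need no Navier–Stokes structure at all.

## References

* [Morrey1958] C. B. Morrey, *On the analyticity of the solutions of analytic non-linear elliptic
  systems of partial differential equations I*, Amer. J. Math. 80 (1958) 198–218
  (doi:10.2307/2372830) — real-analyticity of steady Navier–Stokes flows (tree: proved via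
  Bradshaw–Grujić–Kukavica 2015, see `Literature/Uncategorized/SteadyNSRealAnalytic.lean`).
-/

open scoped BigOperators Topology
open Filter Set MeasureTheory

namespace Summit.AnomalousDissipation.AnomalousDissipation.Theorems

-- the mandated namespace `Summit.<Summit>.<Problem>.Theorems` repeats `AnomalousDissipation` (single-problem summit)
set_option linter.dupNamespace false

namespace DyadicWallCascadeNegative

/-- Identity principle from an arbitrary horizontal slab: an entire real-analytic field that is
`v`-periodic on the slab `c ≤ X₂ ≤ d` (`c < d`) is `v`-periodic everywhere (the tree's
`periodic_of_analytic_of_slab` / `_width` are the slabs centred on the wall). [folklore] -/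
theorem periodic_of_analytic_of_band {W : EuclideanSpace ℝ (Fin 3) → EuclideanSpace ℝ (Fin 3)}
    (hW : AnalyticOnNhd ℝ W Set.univ) (v : EuclideanSpace ℝ (Fin 3)) {c d : ℝ} (hcd : c < d)
    (hv : ∀ X : EuclideanSpace ℝ (Fin 3), c ≤ X 2 → X 2 ≤ d → W (X + v) = W X) :
    ∀ X, W (X + v) = W X := by
  have hin : ∀ X : EuclideanSpace ℝ (Fin 3),
      AnalyticAt ℝ (fun Y : EuclideanSpace ℝ (Fin 3) => Y + v) X := fun X =>
    analyticAt_id.add analyticAt_const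
  have h1 : AnalyticOnNhd ℝ (fun X => W (X + v)) Set.univ := fun X _ =>
    (hW (X + v) trivial).comp (f := fun Y : EuclideanSpace ℝ (Fin 3) => Y + v) (hin X)
  set X₀ : EuclideanSpace ℝ (Fin 3) := ((c + d) / 2) • EuclideanSpace.single (2 : Fin 3) (1 : ℝ)
    with hX₀
  have h2 : (fun X => W (X + v)) =ᶠ[𝓝 X₀] W := by
    have hc3 : Continuous fun X : EuclideanSpace ℝ (Fin 3) => X 2 :=
      PiLp.continuous_apply 2 (fun _ : Fin 3 => ℝ) (2 : Fin 3)
    have hopen : IsOpen {X : EuclideanSpace ℝ (Fin 3) | c < X 2 ∧ X 2 < d} :=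
      (isOpen_lt continuous_const hc3).inter (isOpen_lt hc3 continuous_const)
    have hmem : X₀ ∈ {X : EuclideanSpace ℝ (Fin 3) | c < X 2 ∧ X 2 < d} := by
      have : X₀ 2 = (c + d) / 2 := by simp [hX₀]
      simp only [Set.mem_setOf_eq, this]
      constructor <;> linarith
    filter_upwards [hopen.mem_nhds hmem] with X hX
    exact hv X hX.1.le hX.2.le
  have h3 := AnalyticOnNhd.eq_of_eventuallyEq h1 hW h2
  intro X
  exact congrFun h3 X

/-- A field invariant under `X ↦ 2 • X` and continuous at the origin is constant. [folklore] -/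
theorem eq_apply_zero_of_two_smul_invariant
    {W : EuclideanSpace ℝ (Fin 3) → EuclideanSpace ℝ (Fin 3)} (hc : ContinuousAt W 0)
    (h : ∀ X, W ((2 : ℝ) • X) = W X) (X : EuclideanSpace ℝ (Fin 3)) : W X = W 0 := by
  have hiter : ∀ n : ℕ, W (((2 : ℝ) ^ n)⁻¹ • X) = W X := by
    intro n
    induction n with
    | zero => simp
    | succ n ih =>
      have h2x : (2 : ℝ) • (((2 : ℝ) ^ (n + 1))⁻¹ • X) = ((2 : ℝ) ^ n)⁻¹ • X := by
        rw [smul_smul]; congr 1; rw [pow_succ]; field_simp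
      calc W (((2 : ℝ) ^ (n + 1))⁻¹ • X) = W ((2 : ℝ) • (((2 : ℝ) ^ (n + 1))⁻¹ • X)) := (h _).symm
        _ = W (((2 : ℝ) ^ n)⁻¹ • X) := by rw [h2x]
        _ = W X := ih
  have hlim : Tendsto (fun n : ℕ => ((2 : ℝ) ^ n)⁻¹ • X) atTop (𝓝 0) := by
    have h1 : Tendsto (fun n : ℕ => ((2 : ℝ) ^ n)⁻¹) atTop (𝓝 0) := by
      simpa [inv_pow] using tendsto_pow_atTop_nhds_zero_of_lt_one (by norm_num : (0 : ℝ) ≤ 2⁻¹)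
        (by norm_num : (2 : ℝ)⁻¹ < 1)
    simpa using h1.smul_const X
  have h2 : Tendsto (fun n : ℕ => W (((2 : ℝ) ^ n)⁻¹ • X)) atTop (𝓝 (W 0)) := hc.tendsto.comp hlim
  simp_rw [hiter] at h2
  exact tendsto_nhds_unique tendsto_const_nhds h2

/-- If the trace `q ↦ V (q₁, q₂, 1)` is a constant `w`, zero mass flux through the unit square of
the plane `X₂ = 1` forces zero energy flux (for any `Q`). [folklore] -/
theorem energyFlux_eq_zero_of_const_trace {V : EuclideanSpace ℝ (Fin 3) → EuclideanSpace ℝ (Fin 3)}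
    {Q : EuclideanSpace ℝ (Fin 3) → ℝ} {F : ℝ} (w : EuclideanSpace ℝ (Fin 3))
    (hconst : ∀ q : ℝ × ℝ, V !₂[q.1, q.2, (1 : ℝ)] = w)
    (hmass : ∫ q in Set.Icc (0 : ℝ) 1 ×ˢ Set.Icc (0 : ℝ) 1, (V !₂[q.1, q.2, (1 : ℝ)]) 2 = 0)
    (hflux : ∫ q in Set.Icc (0 : ℝ) 1 ×ˢ Set.Icc (0 : ℝ) 1,
      (V !₂[q.1, q.2, (1 : ℝ)]) 2 * (‖V !₂[q.1, q.2, (1 : ℝ)]‖ ^ 2 / 2 + Q !₂[q.1, q.2, (1 : ℝ)])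
        = F) :
    F = 0 := by
  simp_rw [hconst] at hmass hflux
  have hvol : (volume : Measure (ℝ × ℝ)).real (Set.Icc (0 : ℝ) 1 ×ˢ Set.Icc (0 : ℝ) 1) = 1 := by
    simp only [Measure.real]
    rw [Measure.volume_eq_prod, Measure.prod_prod, Real.volume_Icc]
    simp
  rw [setIntegral_const, hvol, one_smul] at hmass
  rw [hmass] at hflux
  simp at hflux
  exact hflux.symm

end DyadicWallCascadeNegative

open DyadicWallCascadeNegative in
/-- **No exact blow-down level.**  Let `(W, P)` be a `C^∞` solution on all of `ℝ³` of the
stationary force-free Navier–Stokes system at unit viscosity (clauses verbatim as in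
`DyadicWallCascade.ViscousWallProfile`), let its dyadic blow-downs `W (2^m • X)` converge
uniformly on the band `1 ≤ X₂ ≤ 2` to a field `V` that is `1`-periodic in `X₀, X₁` on the band and
differentiable on the open upper half-space, and suppose the blow-down is EXACT at one level `m`:
`W (2^m • X) = V X` on the band.  Then zero mass flux through the unit square of `X₂ = 1` forces
zero energy flux, `F = 0` (for ANY `Q`).  Hence no witness of `ViscousWallProfile` (whose hierarchy
has `F ≠ 0`) matches its hierarchy exactly at any level: `W ≠ V` on every dyadic band and the
convergence in the blow-down clause of the crux `ViscousContinuation` (stmt-17917) is genuinely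
asymptotic — the strengthened crux "`W (2^m •) = V` from some level on" is equivalent to
`¬ HalfSpaceHierarchy`.  Mechanism: exactness makes `2^m • e₀`, `2^m • e₁` periods of `W` on the
slab `2^m ≤ Y₂ ≤ 2^(m+1)`; real-analyticity (`SteadyNSRealAnalytic_holds`) spreads them to `ℝ³`;
the blow-down inherits all periods `2^(m-k) • eᵢ` and is constant along horizontal lines.
[folklore] -/
theorem energyFlux_eq_zero_of_exactLevel_blowdown
    {W V : EuclideanSpace ℝ (Fin 3) → EuclideanSpace ℝ (Fin 3)}
    {P Q : EuclideanSpace ℝ (Fin 3) → ℝ} {F : ℝ} {m : ℕ}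
    (hWs : ContDiff ℝ ((⊤ : ℕ∞) : WithTop ℕ∞) W) (hPs : ContDiff ℝ ((⊤ : ℕ∞) : WithTop ℕ∞) P)
    (hWdiv : ∀ X, ∑ i : Fin 3, (fderiv ℝ W X (EuclideanSpace.single i (1 : ℝ))) i = 0)
    (hNS : ∀ X, (fderiv ℝ W X) (W X) + gradient P X =
      ∑ i : Fin 3, fderiv ℝ (fun Y => fderiv ℝ W Y (EuclideanSpace.single i (1 : ℝ))) X
        (EuclideanSpace.single i (1 : ℝ)))
    (hper : ∀ X : EuclideanSpace ℝ (Fin 3), 1 ≤ X 2 → X 2 ≤ 2 →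
      V (X + EuclideanSpace.single (0 : Fin 3) (1 : ℝ)) = V X ∧
      V (X + EuclideanSpace.single (1 : Fin 3) (1 : ℝ)) = V X)
    (hbd : ∀ ε : ℝ, 0 < ε → ∃ M : ℕ, ∀ m : ℕ, M ≤ m → ∀ X : EuclideanSpace ℝ (Fin 3),
      1 ≤ X 2 → X 2 ≤ 2 → ‖W ((2 : ℝ) ^ m • X) - V X‖ ≤ ε)
    (hexact : ∀ X : EuclideanSpace ℝ (Fin 3), 1 ≤ X 2 → X 2 ≤ 2 → W ((2 : ℝ) ^ m • X) = V X)
    (hVd : ∀ X : EuclideanSpace ℝ (Fin 3), 0 < X 2 → DifferentiableAt ℝ V X)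
    (hmass : ∫ q in Set.Icc (0 : ℝ) 1 ×ˢ Set.Icc (0 : ℝ) 1, (V !₂[q.1, q.2, (1 : ℝ)]) 2 = 0)
    (hflux : ∫ q in Set.Icc (0 : ℝ) 1 ×ˢ Set.Icc (0 : ℝ) 1,
      (V !₂[q.1, q.2, (1 : ℝ)]) 2 * (‖V !₂[q.1, q.2, (1 : ℝ)]‖ ^ 2 / 2 + Q !₂[q.1, q.2, (1 : ℝ)])
        = F) :
    F = 0 := by
  have hWan : AnalyticOnNhd ℝ W Set.univ :=
    Literature.Uncategorized.SteadyNSRealAnalytic_holds W P hWs hPs hWdiv hNS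
  -- exactness at level `m` makes `2^m • eᵢ` (`i = 0, 1`) a period of `W` on the band at level `m`
  have h2m : (0 : ℝ) < (2 : ℝ) ^ m := by positivity
  have hband : ∀ i : Fin 3, (i = 0 ∨ i = 1) → ∀ Y : EuclideanSpace ℝ (Fin 3),
      (2 : ℝ) ^ m ≤ Y 2 → Y 2 ≤ (2 : ℝ) ^ (m + 1) →
      W (Y + (2 : ℝ) ^ m • EuclideanSpace.single i (1 : ℝ)) = W Y := by
    intro i hi Y h1 h2
    set X : EuclideanSpace ℝ (Fin 3) := ((2 : ℝ) ^ m)⁻¹ • Y with hX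
    have hei : (EuclideanSpace.single i (1 : ℝ) : EuclideanSpace ℝ (Fin 3)) 2 = 0 := by
      rcases hi with rfl | rfl <;> simp
    have hX2 : X 2 = ((2 : ℝ) ^ m)⁻¹ * Y 2 := by simp [hX]
    have hX1 : 1 ≤ X 2 := by
      rw [hX2, ← div_eq_inv_mul, le_div_iff₀ h2m]; simpa using h1
    have hX2' : X 2 ≤ 2 := by
      rw [hX2, ← div_eq_inv_mul, div_le_iff₀ h2m]
      calc Y 2 ≤ (2 : ℝ) ^ (m + 1) := h2
        _ = 2 * 2 ^ m := by ring
    have hXe : (X + EuclideanSpace.single i (1 : ℝ)) 2 = X 2 := by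
      rw [PiLp.add_apply, hei, add_zero]
    have hXe1 : 1 ≤ (X + EuclideanSpace.single i (1 : ℝ)) 2 := by rw [hXe]; exact hX1
    have hXe2 : (X + EuclideanSpace.single i (1 : ℝ)) 2 ≤ 2 := by rw [hXe]; exact hX2'
    have hY : Y = (2 : ℝ) ^ m • X := by
      rw [hX, smul_smul, mul_inv_cancel₀ h2m.ne', one_smul]
    have hperi : V (X + EuclideanSpace.single i (1 : ℝ)) = V X := by
      rcases hi with rfl | rfl
      · exact (hper X hX1 hX2').1
      · exact (hper X hX1 hX2').2
    calc W (Y + (2 : ℝ) ^ m • EuclideanSpace.single i (1 : ℝ))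
        = W ((2 : ℝ) ^ m • (X + EuclideanSpace.single i (1 : ℝ))) := by rw [smul_add, ← hY]
      _ = V (X + EuclideanSpace.single i (1 : ℝ)) := hexact _ hXe1 hXe2
      _ = V X := hperi
      _ = W ((2 : ℝ) ^ m • X) := (hexact X hX1 hX2').symm
      _ = W Y := by rw [← hY]
  have hlt : (2 : ℝ) ^ m < (2 : ℝ) ^ (m + 1) := pow_lt_pow_right₀ one_lt_two (Nat.lt_succ_self m)
  set v0 : EuclideanSpace ℝ (Fin 3) := (2 : ℝ) ^ m • EuclideanSpace.single (0 : Fin 3) (1 : ℝ)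
    with hv0
  set v1 : EuclideanSpace ℝ (Fin 3) := (2 : ℝ) ^ m • EuclideanSpace.single (1 : Fin 3) (1 : ℝ)
    with hv1
  -- analyticity spreads the periods to all of `ℝ³`
  have hP0 : ∀ Y, W (Y + v0) = W Y :=
    periodic_of_analytic_of_band hWan v0 hlt (hband 0 (Or.inl rfl))
  have hP1 : ∀ Y, W (Y + v1) = W Y :=
    periodic_of_analytic_of_band hWan v1 hlt (hband 1 (Or.inr rfl))
  -- hence the blow-down limit is constant along both horizontal axes through the plane `X₂ = 1`
  have he0 : v0 2 = 0 := by simp [hv0]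
  have he1 : v1 2 = 0 := by simp [hv1]
  have hpt2 : ∀ p q : ℝ, (!₂[p, q, (1 : ℝ)] : EuclideanSpace ℝ (Fin 3)) 2 = 1 := by
    intro p q; simp
  have hline0 : ∀ p q : ℝ, (!₂[p, q, (1 : ℝ)] : EuclideanSpace ℝ (Fin 3))
      = !₂[(0 : ℝ), q, (1 : ℝ)] + (p / (2 : ℝ) ^ m) • v0 := by
    intro p q; ext i; fin_cases i <;> simp [hv0]
  have hline1 : ∀ q : ℝ, (!₂[(0 : ℝ), q, (1 : ℝ)] : EuclideanSpace ℝ (Fin 3))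
      = !₂[(0 : ℝ), (0 : ℝ), (1 : ℝ)] + (q / (2 : ℝ) ^ m) • v1 := by
    intro q; ext i; fin_cases i <;> simp [hv1]
  have hconst : ∀ q : ℝ × ℝ, V !₂[q.1, q.2, (1 : ℝ)] = V !₂[(0 : ℝ), (0 : ℝ), (1 : ℝ)] := by
    intro q
    rw [hline0 q.1 q.2, const_on_line he0 (periodic_nat_mul _ hP0) hbd hVd _
      (by rw [hpt2]) (by rw [hpt2]; norm_num), hline1 q.2,
      const_on_line he1 (periodic_nat_mul _ hP1) hbd hVd _ (by rw [hpt2]) (by rw [hpt2]; norm_num)]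
  exact energyFlux_eq_zero_of_const_trace _ hconst hmass hflux

open DyadicWallCascadeNegative in
/-- **No discretely self-similar profile.**  If `W` is continuous at the origin and invariant
under `X ↦ 2 • X`, then `W` is constant; if moreover its dyadic blow-downs converge on the band to
`V`, then the trace of `V` on `X₂ = 1` is that constant and zero mass flux forces zero energy
flux (for any `Q`).  So no witness of `ViscousWallProfile` has `W (2 • X) = W X`: the viscous cap
carries no exact scaling symmetry; the dyadic structure is the hierarchy's alone. [folklore] -/
theorem energyFlux_eq_zero_of_two_smul_invariant
    {W V : EuclideanSpace ℝ (Fin 3) → EuclideanSpace ℝ (Fin 3)}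
    {Q : EuclideanSpace ℝ (Fin 3) → ℝ} {F : ℝ}
    (hWc : ContinuousAt W 0) (hss : ∀ X, W ((2 : ℝ) • X) = W X)
    (hbd : ∀ ε : ℝ, 0 < ε → ∃ M : ℕ, ∀ m : ℕ, M ≤ m → ∀ X : EuclideanSpace ℝ (Fin 3),
      1 ≤ X 2 → X 2 ≤ 2 → ‖W ((2 : ℝ) ^ m • X) - V X‖ ≤ ε)
    (hmass : ∫ q in Set.Icc (0 : ℝ) 1 ×ˢ Set.Icc (0 : ℝ) 1, (V !₂[q.1, q.2, (1 : ℝ)]) 2 = 0)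
    (hflux : ∫ q in Set.Icc (0 : ℝ) 1 ×ˢ Set.Icc (0 : ℝ) 1,
      (V !₂[q.1, q.2, (1 : ℝ)]) 2 * (‖V !₂[q.1, q.2, (1 : ℝ)]‖ ^ 2 / 2 + Q !₂[q.1, q.2, (1 : ℝ)])
        = F) :
    F = 0 := by
  have hW : ∀ X, W X = W 0 := eq_apply_zero_of_two_smul_invariant hWc hss
  have hV : ∀ X : EuclideanSpace ℝ (Fin 3), 1 ≤ X 2 → X 2 ≤ 2 → V X = W 0 := by
    intro X h1 h2
    refine (eq_of_forall_dist_le fun ε hε => ?_).symm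
    obtain ⟨M, hM⟩ := hbd ε hε
    have := hM M le_rfl X h1 h2
    rwa [hW, ← dist_eq_norm] at this
  have hpt2 : ∀ p q : ℝ, (!₂[p, q, (1 : ℝ)] : EuclideanSpace ℝ (Fin 3)) 2 = 1 := by
    intro p q; simp
  exact energyFlux_eq_zero_of_const_trace (W 0)
    (fun q => hV _ (by rw [hpt2]) (by rw [hpt2]; norm_num)) hmass hflux

open DyadicWallCascadeNegative in
/-- **The profile never coincides with its hierarchy on the whole half-space.**  If `W` is
continuous at the origin and agrees on the open upper half-space with a field `V` that is
invariant there under `X ↦ 2 • X`, then `V` is constant on the half-space (iterate the dilation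
down to the origin and use continuity of `W`), so zero mass flux forces zero energy flux (for any
`Q`).  A witness of `ViscousWallProfile` therefore differs from `V` somewhere above the wall; the
quantitative form (it differs on every band) is `energyFlux_eq_zero_of_exactLevel_blowdown`.
[folklore] -/
theorem energyFlux_eq_zero_of_eq_on_halfSpace
    {W V : EuclideanSpace ℝ (Fin 3) → EuclideanSpace ℝ (Fin 3)}
    {Q : EuclideanSpace ℝ (Fin 3) → ℝ} {F : ℝ}
    (hWc : ContinuousAt W 0)
    (hdil : ∀ X : EuclideanSpace ℝ (Fin 3), 0 < X 2 → V ((2 : ℝ) • X) = V X)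
    (heq : ∀ X : EuclideanSpace ℝ (Fin 3), 0 < X 2 → W X = V X)
    (hmass : ∫ q in Set.Icc (0 : ℝ) 1 ×ˢ Set.Icc (0 : ℝ) 1, (V !₂[q.1, q.2, (1 : ℝ)]) 2 = 0)
    (hflux : ∫ q in Set.Icc (0 : ℝ) 1 ×ˢ Set.Icc (0 : ℝ) 1,
      (V !₂[q.1, q.2, (1 : ℝ)]) 2 * (‖V !₂[q.1, q.2, (1 : ℝ)]‖ ^ 2 / 2 + Q !₂[q.1, q.2, (1 : ℝ)])
        = F) :
    F = 0 := by
  have hVc : ∀ X : EuclideanSpace ℝ (Fin 3), 0 < X 2 → V X = W 0 := by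
    intro X hX
    have hposn : ∀ n : ℕ, 0 < (((2 : ℝ) ^ n)⁻¹ • X) 2 := by
      intro n; simp only [PiLp.smul_apply, smul_eq_mul]; positivity
    have hiter : ∀ n : ℕ, V (((2 : ℝ) ^ n)⁻¹ • X) = V X := by
      intro n
      induction n with
      | zero => simp
      | succ n ih =>
        have h2x : (2 : ℝ) • (((2 : ℝ) ^ (n + 1))⁻¹ • X) = ((2 : ℝ) ^ n)⁻¹ • X := by
          rw [smul_smul]; congr 1; rw [pow_succ]; field_simp
        calc V (((2 : ℝ) ^ (n + 1))⁻¹ • X) = V ((2 : ℝ) • (((2 : ℝ) ^ (n + 1))⁻¹ • X)) :=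
              (hdil _ (hposn (n + 1))).symm
          _ = V (((2 : ℝ) ^ n)⁻¹ • X) := by rw [h2x]
          _ = V X := ih
    have hWn : ∀ n : ℕ, W (((2 : ℝ) ^ n)⁻¹ • X) = V X := fun n => by rw [heq _ (hposn n), hiter n]
    have hlim : Tendsto (fun n : ℕ => ((2 : ℝ) ^ n)⁻¹ • X) atTop (𝓝 0) := by
      have h1 : Tendsto (fun n : ℕ => ((2 : ℝ) ^ n)⁻¹) atTop (𝓝 0) := by
        simpa [inv_pow] using tendsto_pow_atTop_nhds_zero_of_lt_one (by norm_num : (0 : ℝ) ≤ 2⁻¹)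
          (by norm_num : (2 : ℝ)⁻¹ < 1)
      simpa using h1.smul_const X
    have h2 : Tendsto (fun n : ℕ => W (((2 : ℝ) ^ n)⁻¹ • X)) atTop (𝓝 (W 0)) :=
      hWc.tendsto.comp hlim
    simp_rw [hWn] at h2
    exact tendsto_nhds_unique tendsto_const_nhds h2
  have hpt2 : ∀ p q : ℝ, (!₂[p, q, (1 : ℝ)] : EuclideanSpace ℝ (Fin 3)) 2 = 1 := by
    intro p q; simp
  exact energyFlux_eq_zero_of_const_trace (W 0) (fun q => hVc _ (by rw [hpt2]; norm_num))
    hmass hflux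

end Summit.AnomalousDissipation.AnomalousDissipation.Theorems
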